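/-
Copyright (c) 2026 the pub-hodgecm-mathlib formalisation cell (harness21).  Prover seat hodgecm-mathlib-LH4-p07 (g9), req620 Track A «(D-RAM) FOUR-FRAME» squad
(STAGE-1b, row-(2) lineage; dealer LH4-plan (g13) WORD #58 RULING A ∕ #59 ∕ #64 ∕ #65: owner of the two-literal census law of `lev_{a,m}`, RamK lane), 2026-09-04.
-/
import Summits.HodgeConjecture.HodgeConjecture.Theorems.F0P3cDyRamToricCensusSumRamKWeldCut      -- ★ p859906 (this seat): `toricCensusSum_ramK_weld_cut`
import Summits.HodgeConjecture.HodgeConjecture.Theorems.F0P3cDyRamToricCensusSumRamKWeldCutFlip  -- ★ p859944 (this seat): `toricCensusSum_ramK_weld_cut_flip`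
import Summits.HodgeConjecture.HodgeConjecture.Theorems.F0P3cDyRamToricCensusSumCutReindex      -- ★ p859781 (this seat): `cutOrderCounts_eq_cutCensusSum_of_cells`, `sub_eq_sum_ite_sub`
import Summits.HodgeConjecture.HodgeConjecture.Theorems.F0P3cDyRamOrderFiltrationRange         -- ★ (LH4 GAP lineage): `isOrd_pow_iff_le`
import HarnessLib

/-!
# Crux `H413`, line LH4 «(D-RAM) FOUR-FRAME» — STAGE-1b, row (2): (OC-weldΔ)-RamK «THE LEVEL-PIECE WELD IN ORDER-COUNT CURRENCY, TYPE RamK»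
# `ε·(cutOC_h(μ₁) − cutOC_{h′}(μ₁)) = W(m₁, jl₁, C)` — both parity lanes

Cell `hodgecm-mathlib` (D-0151), FLOOR 0, crux item H413 = `stmt-HodgeConjecture-24833`, route of record `HCCMUnconditional`; squad F0∕P3c∕LH4; lane
`--supports stmt-HodgeConjecture-24833 --as helper` (count-neutral; pays NO tier-0 row).  THEOREMS ONLY (no `def`, no instance, no notation, no `sorry`, default heartbeats).
OWNER'S ORGAN №9 for the END `levels_typeTwo_censusLaw` — the twin, for the level pieces, of the step «(B-3) reindex ∘ (B-2) weld» inside ★ `F0P3cDyRamOrderCountCensusRamK.orderCountCensusB`.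

THE OBJECT.  The bottom socket of the level-piece law receives the G-side in ORDER-COUNT currency (★ p859485 LH4-p04 (g7) at the CM place ∘ (β′) weights ∘ this seat's ★ p859713
cutoff): per literal, `cutOC(μ₁) = Σ_{j ≤ jl₁} #levelSet(j, 0) + Σ_{b ∈ Icc 1 R} Σ_{j ≤ jl₁} [j + b ≤ C]·q^b·#levelSetDep(j, b; μ₁)` over the cells of the SCALED cone multiplier
`μ₁ = t⁻¹(λ − u)` (`|t| = exp(−e)`, `e = a′`), rows up to `μ₁`'s conductor `jl₁ = jλ − e`, the diagonal cutoff `C = m + jλ − b′`, and a depth bound `R` on the non-empty cells.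
THIS FILE welds the two literals in that currency, in ★ p859906's one-field RamK frame VERBATIM plus the two cell-depth letters `hRh`, `hRh′`
(`∀ j b, 1 ≤ b → j ≤ jl₁ → levelSetDep(j, b; μ₁) ≠ ∅ → b ≤ R`):
* **`levelOrderCounts_ramK_weld_cut`** (even `e`, standard parity lane) ⊢ `ε·((cutOC_h : ℕ) − (cutOC_{h′} : ℕ)) = q^{m₁}(2[(jl₁−d)∕2+1]_q − 2[d−d%2]_q) − 2Σ_{band} q^{a+⌊jl₁∕2⌋}` (★ p859906's value);
* **`levelOrderCounts_ramK_weld_cut_flip`** (odd `e`, flipped lane) ⊢ the same with ★ p859944's flipped value.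
Proof: `μ₁`'s tokens `(m₁, jl₁)` and order filtration `μ₁ ∈ 𝒪_j ↔ j ≤ jl₁` (★ `isOrd_pow_iff_le`), ★ p859781 `cutOrderCounts_eq_cutCensusSum_of_cells` on both literals, `push_cast`,
★ `sub_eq_sum_ite_sub`, ★ p859906 ∕ ★ p859944.  Downstream: ★∕cand `F0P3cDyRamLevelsCensusLawArithRamK.law_arith_{sq, levLo_odd, levHi_even, levHi_odd}` turn the value into
`2q^m(q^{(jλ−d)∕2+1} − q^{shiftR d + bs})∕((q−1)q^{ks})`, and `law_template` + ★ (NV) p859839 into ★ p859606's `cA∕2·(#Fix + d%2) + cB∕2`.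
HONEST LABEL.  Count-neutral; one-field frame, no CM place, no law asserted; `HC_CM` is proved only modulo the 7 printed citations (2 remaining named inputs: hLiu418 =
`stmt-HodgeConjecture-24832`, h413 = `stmt-HodgeConjecture-24833`) until rung 0 closes.

## References
* [Kottwitz1986BaseChangeUnits] R. E. Kottwitz, *Base change for unit elements of Hecke algebras*, Compositio Math. 60 (1986): §1 pp. 240–241.
* [Rogawski1990] J. D. Rogawski, *Automorphic Representations of Unitary Groups in Three Variables*, Ann. of Math. Stud. 123 (1990): §4.9 Prop. 4.9.1 (b) p. 55, Lemma 4.9.3 p. 56.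
* [Flicker1998UnitaryFL] Y. Z. Flicker, *Elementary proof of the fundamental lemma for a unitary group*, Canad. J. Math. 50 (1998): Prop. 7 p. 84.
* [Serre1979] J.-P. Serre, *Local Fields*, GTM 67 (1979): Ch. V §3 Prop. 5, Cor. 3.
-/

set_option autoImplicit false

namespace Summit.HodgeConjecture.HodgeConjecture.Cruxes.H413.F0P3cDyRamLevelOrderCountsRamKWeldCut

open WithZero IsLocalRing Finset
open scoped Valued Classical
open Literature.NumberTheory.Automorphic.UnitaryThreeFourFrame (IsRamifiedQuadraticDatum)
open Summit.HodgeConjecture.HodgeConjecture.Cruxes.H413.F0P3cDyRamToricCensusDefs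
open Summit.HodgeConjecture.HodgeConjecture.Cruxes.H413.F0P3cDyRamOrderFiltrationRange (isOrd_pow_iff_le)
open Summit.HodgeConjecture.HodgeConjecture.Cruxes.H413.F0P3cDyRamToricCensusSumCutReindex (cutOrderCounts_eq_cutCensusSum_of_cells sub_eq_sum_ite_sub)
open Summit.HodgeConjecture.HodgeConjecture.Cruxes.H413.F0P3cDyRamToricCensusSumRamKWeldCut (toricCensusSum_ramK_weld_cut)
open Summit.HodgeConjecture.HodgeConjecture.Cruxes.H413.F0P3cDyRamToricCensusSumRamKWeldCutFlip (toricCensusSum_ramK_weld_cut_flip)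

variable {K : Type} [Field K] [Valued K ℤᵐ⁰] {ρ Θ : K →+* K} {α ϖE : K}

/-! ## §1 Standard parity lane (even `e`) -/

/-- **(OC-weldΔ)-RamK, STANDARD LANE.**  ★ p859906's frame and letters VERBATIM + the cell-depth letters `hRh`, `hRh′`: the two literals' CUT ORDER COUNTS over the cells of
`μ₁ = t⁻¹(λ − u)` differ, after the sign `ε`, by ★ p859906's value `q^{m₁}(2[(jl₁−d)∕2+1]_q − 2[d−d%2]_q) − 2Σ_{band(m₁, jl₁, C)} q^{a+⌊jl₁∕2⌋}`.
[cite: Kottwitz1986BaseChangeUnits, §1 pp. 240–241] [cite: Rogawski1990, §4.9 Prop. 4.9.1 (b) p. 55, Lemma 4.9.3 p. 56] [cite: Flicker1998UnitaryFL, Prop. 7 p. 84] [cite: Serre1979, Ch. V §3 Prop. 5, Cor. 3] -/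
theorem levelOrderCounts_ramK_weld_cut [CompleteSpace K] [IsDiscreteValuationRing 𝒪[K]] [Finite 𝓀[K]]
    (hρρ : ∀ x, ρ (ρ x) = x) (hvρ : ∀ x, Valued.v (ρ x) = Valued.v x) (hΘρ : ∀ x, Θ (ρ x) = ρ (Θ x))
    (hα1 : Valued.v α ≤ 1) (hα : Valued.v (α - ρ α) = 1) {d t : ℕ} (hD : IsRamifiedQuadraticDatum Θ ϖE d t) (hρϖ : ρ ϖE = ϖE)
    {q : ℕ} (hq : Nat.card 𝓀[K] = q ^ 2)
    (hσres : ∀ z : K, ρ z = z → Valued.v z ≤ 1 → Valued.v (Θ z - z) < 1) (hram : Valued.v (α - Θ α) < 1)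
    {h h' : K} (hΘh : Θ h = h) (hh : h ≠ 0) (hhyper : ∃ x : K, x ≠ 0 ∧ h * Θ x * x + ρ (h * Θ x * x) = 0)
    (hΘh' : Θ h' = h') (hh' : h' ≠ 0) (haniso : ¬ ∃ x : K, x ≠ 0 ∧ h' * Θ x * x + ρ (h' * Θ x * x) = 0)
    {lam u : K} (hlam : lam * Θ lam = 1) (hu : ρ u = u) (hu1 : u * Θ u = 1)
    {m jl : ℕ} (hm : Valued.v (lam - u) = exp (-(m : ℤ))) (hjl : Valued.v ((lam - u) - ρ (lam - u)) = exp (-(jl : ℤ)))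
    (hd2 : 2 ≤ d) (hmpar : m % 2 = d % 2)
    {tc : K} (hρt : ρ tc = tc) {e : ℕ} (hte : Valued.v tc = exp (-(e : ℤ))) (he2 : e % 2 = 0) (hed : e ≤ d)
    {m₁ jl₁ : ℕ} (hme : m₁ + e = m) (hjle : jl₁ + e = jl) (hjlS : 3 * d ≤ jl₁ + 2 + 2 * (d % 2)) (hmS : d - d % 2 ≤ m₁ + 1)
    (ε : ℚ) (hε1 : ε = 1 ∨ ε = -1)
    (hside : 3 * d ≤ jl + 2 → ∃ c₀ : ℕ, 2 * d ≤ c₀ + 1 ∧ c₀ + d ≤ jl + 1 ∧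
      (ε = 1 ↔ ∃ ω₁ : Kˣ, Valued.v (ω₁ : K) = 1 ∧
        Valued.v (1 + ρ h / h / (ρ (lam - u) / (lam - u)) * (ρ ((ω₁ : K) * Θ ω₁) / ((ω₁ : K) * Θ ω₁))) ≤ exp (-(c₀ : ℤ))))
    (C : ℕ) (hC : jl₁ ≤ C) (hCe : C + d ≤ m₁ + jl₁ + 1) {R R' : ℕ}
    (hRh : ∀ j b, 1 ≤ b → j ≤ jl₁ → (levelSetDep ρ Θ α ϖE h j b (tc⁻¹ * (lam - u))).Nonempty → b ≤ R)
    (hRh' : ∀ j b, 1 ≤ b → j ≤ jl₁ → (levelSetDep ρ Θ α ϖE h' j b (tc⁻¹ * (lam - u))).Nonempty → b ≤ R') :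
    ε * (((((∑ j ∈ range (jl₁ + 1), (levelSet ρ Θ α ϖE h j 0).ncard) +
            ∑ b ∈ Icc 1 R, ∑ j ∈ range (jl₁ + 1), (if j + b ≤ C then q ^ b * (levelSetDep ρ Θ α ϖE h j b (tc⁻¹ * (lam - u))).ncard else 0) : ℕ) : ℚ)) -
          ((((∑ j ∈ range (jl₁ + 1), (levelSet ρ Θ α ϖE h' j 0).ncard) +
            ∑ b ∈ Icc 1 R', ∑ j ∈ range (jl₁ + 1), (if j + b ≤ C then q ^ b * (levelSetDep ρ Θ α ϖE h' j b (tc⁻¹ * (lam - u))).ncard else 0) : ℕ) : ℚ))) =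
      (q : ℚ) ^ m₁ * (2 * ∑ i ∈ range ((jl₁ - d) / 2 + 1), (q : ℚ) ^ i - 2 * ∑ i ∈ range (d - d % 2), (q : ℚ) ^ i) -
        2 * ∑ a ∈ (range (jl₁ + 2)).filter (fun a => a ≤ m₁ ∧ C + m₁ < jl₁ + 2 * a ∧ 2 * m₁ + 2 * d < jl₁ + 2 * a + 2 ∧ 2 * a + d ≤ 2 * m₁ + 1),
          (q : ℚ) ^ (a + jl₁ / 2) := by
  classical
  have hΘΘ : ∀ x, Θ (Θ x) = x := hD.1
  have hvΘ : ∀ x, Valued.v (Θ x) = Valued.v x := hD.2.1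
  have hϖE : Valued.v ϖE = exp (-1 : ℤ) := hD.2.2.1
  have hϖE0 : ϖE ≠ 0 := fun h0 => by rw [h0, map_zero] at hϖE; exact (exp_ne_zero hϖE.symm).elim
  have hϖE1 : Valued.v ϖE < 1 := by rw [hϖE, ← exp_zero, exp_lt_exp]; omega
  have hα' : ρ α ≠ α := fun h0 => by rw [h0, sub_self, map_zero] at hα; exact zero_ne_one hα
  -- the scaled multiplier's tokens
  have hm1 : Valued.v (tc⁻¹ * (lam - u)) = exp (-(m₁ : ℤ)) := by
    rw [map_mul, map_inv₀, hte, hm, ← exp_neg, ← exp_add]; congr 1; omega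
  have hjl1 : Valued.v (tc⁻¹ * (lam - u) - ρ (tc⁻¹ * (lam - u))) = exp (-(jl₁ : ℤ)) := by
    rw [show tc⁻¹ * (lam - u) - ρ (tc⁻¹ * (lam - u)) = tc⁻¹ * ((lam - u) - ρ (lam - u)) by rw [map_mul, map_inv₀, hρt]; ring,
      map_mul, map_inv₀, hte, hjl, ← exp_neg, ← exp_add]; congr 1; omega
  have hμle : Valued.v (tc⁻¹ * (lam - u)) ≤ 1 := by rw [hm1, ← exp_zero, exp_le_exp]; omega
  -- the order filtration of `μ₁`: `μ₁ ∈ 𝒪_j ↔ j ≤ jl₁`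
  have hiff : ∀ j, IsOrd ρ α (ϖE ^ j) (tc⁻¹ * (lam - u)) ↔ j ≤ jl₁ := fun j =>
    isOrd_pow_iff_le hα' hϖE0 hϖE1 hμle (by rw [hjl1, hα, mul_one, hϖE, ← exp_nsmul, nsmul_eq_mul, mul_neg, mul_one]) j
  -- ★ p859781: both literals re-indexed into the cut weld's row∕column shape
  rw [cutOrderCounts_eq_cutCensusSum_of_cells hρρ hvρ hΘΘ hΘρ hvΘ hα1 hα hρϖ hϖE hh hm1 hjl1 q hiff hC
      (fun j b hb hj hne => hRh j b hb ((hiff j).1 hj) hne),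
    cutOrderCounts_eq_cutCensusSum_of_cells hρρ hvρ hΘΘ hΘρ hvΘ hα1 hα hρϖ hϖE hh' hm1 hjl1 q hiff hC
      (fun j b hb hj hne => hRh' j b hb ((hiff j).1 hj) hne)]
  push_cast
  rw [sub_eq_sum_ite_sub]
  exact toricCensusSum_ramK_weld_cut hρρ hvρ hΘρ hα1 hα hD hρϖ hq hσres hram hΘh hh hhyper hΘh' hh' haniso hlam hu hu1 hm hjl hd2 hmpar hρt hte he2 hed
    hme hjle hjlS hmS ε hε1 hside C hC hCe

/-! ## §2 Flipped parity lane (odd `e`) -/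

/-- **(OC-weldΔ)-RamK, FLIPPED LANE.**  The same with `e` odd and ★ p859875's guards `3d ≤ jl₁ + 3`, `d ≤ m₁ + 1`; value ★ p859944's
`q^{m₁}(2[(jl₁−d+1)∕2 + d%2]_q − 2[d−1+d%2]_q) − 2Σ_{band} q^{a+⌊jl₁∕2⌋}`.
[cite: Kottwitz1986BaseChangeUnits, §1 pp. 240–241] [cite: Rogawski1990, §4.9 Prop. 4.9.1 (b) p. 55, Lemma 4.9.3 p. 56] [cite: Flicker1998UnitaryFL, Prop. 7 p. 84] [cite: Serre1979, Ch. V §3 Prop. 5, Cor. 3] -/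
theorem levelOrderCounts_ramK_weld_cut_flip [CompleteSpace K] [IsDiscreteValuationRing 𝒪[K]] [Finite 𝓀[K]]
    (hρρ : ∀ x, ρ (ρ x) = x) (hvρ : ∀ x, Valued.v (ρ x) = Valued.v x) (hΘρ : ∀ x, Θ (ρ x) = ρ (Θ x))
    (hα1 : Valued.v α ≤ 1) (hα : Valued.v (α - ρ α) = 1) {d t : ℕ} (hD : IsRamifiedQuadraticDatum Θ ϖE d t) (hρϖ : ρ ϖE = ϖE)
    {q : ℕ} (hq : Nat.card 𝓀[K] = q ^ 2)
    (hσres : ∀ z : K, ρ z = z → Valued.v z ≤ 1 → Valued.v (Θ z - z) < 1) (hram : Valued.v (α - Θ α) < 1)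
    {h h' : K} (hΘh : Θ h = h) (hh : h ≠ 0) (hhyper : ∃ x : K, x ≠ 0 ∧ h * Θ x * x + ρ (h * Θ x * x) = 0)
    (hΘh' : Θ h' = h') (hh' : h' ≠ 0) (haniso : ¬ ∃ x : K, x ≠ 0 ∧ h' * Θ x * x + ρ (h' * Θ x * x) = 0)
    {lam u : K} (hlam : lam * Θ lam = 1) (hu : ρ u = u) (hu1 : u * Θ u = 1)
    {m jl : ℕ} (hm : Valued.v (lam - u) = exp (-(m : ℤ))) (hjl : Valued.v ((lam - u) - ρ (lam - u)) = exp (-(jl : ℤ)))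
    (hd2 : 2 ≤ d) (hmpar : m % 2 = d % 2)
    {tc : K} (hρt : ρ tc = tc) {e : ℕ} (hte : Valued.v tc = exp (-(e : ℤ))) (he2 : e % 2 = 1) (hed : e ≤ d)
    {m₁ jl₁ : ℕ} (hme : m₁ + e = m) (hjle : jl₁ + e = jl) (hjlS : 3 * d ≤ jl₁ + 3) (hmS : d ≤ m₁ + 1)
    (ε : ℚ) (hε1 : ε = 1 ∨ ε = -1)
    (hside : 3 * d ≤ jl + 2 → ∃ c₀ : ℕ, 2 * d ≤ c₀ + 1 ∧ c₀ + d ≤ jl + 1 ∧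
      (ε = 1 ↔ ∃ ω₁ : Kˣ, Valued.v (ω₁ : K) = 1 ∧
        Valued.v (1 + ρ h / h / (ρ (lam - u) / (lam - u)) * (ρ ((ω₁ : K) * Θ ω₁) / ((ω₁ : K) * Θ ω₁))) ≤ exp (-(c₀ : ℤ))))
    (C : ℕ) (hC : jl₁ ≤ C) (hCe : C + d ≤ m₁ + jl₁ + 1) {R R' : ℕ}
    (hRh : ∀ j b, 1 ≤ b → j ≤ jl₁ → (levelSetDep ρ Θ α ϖE h j b (tc⁻¹ * (lam - u))).Nonempty → b ≤ R)
    (hRh' : ∀ j b, 1 ≤ b → j ≤ jl₁ → (levelSetDep ρ Θ α ϖE h' j b (tc⁻¹ * (lam - u))).Nonempty → b ≤ R') :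
    ε * (((((∑ j ∈ range (jl₁ + 1), (levelSet ρ Θ α ϖE h j 0).ncard) +
            ∑ b ∈ Icc 1 R, ∑ j ∈ range (jl₁ + 1), (if j + b ≤ C then q ^ b * (levelSetDep ρ Θ α ϖE h j b (tc⁻¹ * (lam - u))).ncard else 0) : ℕ) : ℚ)) -
          ((((∑ j ∈ range (jl₁ + 1), (levelSet ρ Θ α ϖE h' j 0).ncard) +
            ∑ b ∈ Icc 1 R', ∑ j ∈ range (jl₁ + 1), (if j + b ≤ C then q ^ b * (levelSetDep ρ Θ α ϖE h' j b (tc⁻¹ * (lam - u))).ncard else 0) : ℕ) : ℚ))) =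
      (q : ℚ) ^ m₁ * (2 * ∑ i ∈ range ((jl₁ - d + 1) / 2 + d % 2), (q : ℚ) ^ i - 2 * ∑ i ∈ range (d - 1 + d % 2), (q : ℚ) ^ i) -
        2 * ∑ a ∈ (range (jl₁ + 2)).filter (fun a => a ≤ m₁ ∧ C + m₁ < jl₁ + 2 * a ∧ 2 * m₁ + 2 * d < jl₁ + 2 * a + 2 ∧ 2 * a + d ≤ 2 * m₁ + 1),
          (q : ℚ) ^ (a + jl₁ / 2) := by
  classical
  have hΘΘ : ∀ x, Θ (Θ x) = x := hD.1
  have hvΘ : ∀ x, Valued.v (Θ x) = Valued.v x := hD.2.1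
  have hϖE : Valued.v ϖE = exp (-1 : ℤ) := hD.2.2.1
  have hϖE0 : ϖE ≠ 0 := fun h0 => by rw [h0, map_zero] at hϖE; exact (exp_ne_zero hϖE.symm).elim
  have hϖE1 : Valued.v ϖE < 1 := by rw [hϖE, ← exp_zero, exp_lt_exp]; omega
  have hα' : ρ α ≠ α := fun h0 => by rw [h0, sub_self, map_zero] at hα; exact zero_ne_one hα
  -- the scaled multiplier's tokens
  have hm1 : Valued.v (tc⁻¹ * (lam - u)) = exp (-(m₁ : ℤ)) := by
    rw [map_mul, map_inv₀, hte, hm, ← exp_neg, ← exp_add]; congr 1; omega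
  have hjl1 : Valued.v (tc⁻¹ * (lam - u) - ρ (tc⁻¹ * (lam - u))) = exp (-(jl₁ : ℤ)) := by
    rw [show tc⁻¹ * (lam - u) - ρ (tc⁻¹ * (lam - u)) = tc⁻¹ * ((lam - u) - ρ (lam - u)) by rw [map_mul, map_inv₀, hρt]; ring,
      map_mul, map_inv₀, hte, hjl, ← exp_neg, ← exp_add]; congr 1; omega
  have hμle : Valued.v (tc⁻¹ * (lam - u)) ≤ 1 := by rw [hm1, ← exp_zero, exp_le_exp]; omega
  -- the order filtration of `μ₁`: `μ₁ ∈ 𝒪_j ↔ j ≤ jl₁`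
  have hiff : ∀ j, IsOrd ρ α (ϖE ^ j) (tc⁻¹ * (lam - u)) ↔ j ≤ jl₁ := fun j =>
    isOrd_pow_iff_le hα' hϖE0 hϖE1 hμle (by rw [hjl1, hα, mul_one, hϖE, ← exp_nsmul, nsmul_eq_mul, mul_neg, mul_one]) j
  -- ★ p859781: both literals re-indexed into the cut weld's row∕column shape
  rw [cutOrderCounts_eq_cutCensusSum_of_cells hρρ hvρ hΘΘ hΘρ hvΘ hα1 hα hρϖ hϖE hh hm1 hjl1 q hiff hC
      (fun j b hb hj hne => hRh j b hb ((hiff j).1 hj) hne),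
    cutOrderCounts_eq_cutCensusSum_of_cells hρρ hvρ hΘΘ hΘρ hvΘ hα1 hα hρϖ hϖE hh' hm1 hjl1 q hiff hC
      (fun j b hb hj hne => hRh' j b hb ((hiff j).1 hj) hne)]
  push_cast
  rw [sub_eq_sum_ite_sub]
  exact toricCensusSum_ramK_weld_cut_flip hρρ hvρ hΘρ hα1 hα hD hρϖ hq hσres hram hΘh hh hhyper hΘh' hh' haniso hlam hu hu1 hm hjl hd2 hmpar hρt hte he2 hed
    hme hjle hjlS hmS ε hε1 hside C hC hCe

end Summit.HodgeConjecture.HodgeConjecture.Cruxes.H413.F0P3cDyRamLevelOrderCountsRamKWeldCut
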